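import Summits.SmoothPoincare4.SmoothPoincare4.Theorems.SymplecticOrigamiGromovRecognitionRelEndGlueData
import Summits.SmoothPoincare4.SmoothPoincare4.Theorems.SymplecticOrigamiGromovRecognitionRelEndCountOneStructure
import Summits.SmoothPoincare4.SmoothPoincare4.Theorems.SymplecticOrigamiGromovRecognitionRelEndCaseBCounts
import Literature.Geometry.Symplectic.JCurveIntersectionCountHomological
import Literature.AlgebraicTopology.SingularHomology.SingularChains

/-!
# Every sphere in the class of the reference sphere meets the small `H`-levels with count one
(registered helpers `helper_holCoordinate_surjective`, `helper_leaf_ref`, `helper_class_count`,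
`helper_leaf_meetsOnce` of line `cross-cap-laurent`, crux `GromovRecognitionRelEnd`,
item stmt-SmoothPoincare4-11009; integration lemmas L0–L3 of the glue of the bi-foliation)

Setting: the data `FoliationData ωX JX u₀ v₀ uH vH F₀ TH TV UH UV δ` of one foliation of the wedge
cap (`…GlueData`): the reference sphere `S₀ = (u₀, v₀)` with glued map `F₀`, the transverse wedge
sphere `S_H = (uH, vH)`, the `JX`-holomorphic wedge coordinates `TH` on `UH` and `TV` on `UV` with
compact small levels, and the count `S₀ · {TH = t} = 1` for `‖t‖ < δ`.

* L0 `helper_holCoordinate_surjective`: a holomorphic coordinate is a submersion.  The differential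
  `ℓ = dT_y : T_y X → ℂ` is real-linear, non-zero and complex-linear for `JX` (`ℓ (JX w) = i ℓ w`);
  if `ℓ w = a ≠ 0` then `ℓ (s • w + r • JX w) = (s + r i) a` exhausts `ℂ`
  (`surjective_of_map_J_eq_I_mul`).
* L1 `helper_leaf_ref`: the reference sphere is a leaf of its own family: sphere / embedded / glued
  are fields of the data (homotopy `refl`), and `(UV, TV)` is a trivial-normal-bundle witness
  (`coordV`, submersive by L0, zero set `zeroSetV`).
* L2 `helper_class_count`: for `‖t‖ < δ`, every `JX`-two-chart sphere `(u, v)` whose glued map `F`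
  is homotopic to `F₀` has `wedgeCount (TH - t) UH u v = 1` and is not inside the level
  `K_t = {y ∈ UH | TH y = t}`.  The vendored fact `jSphere_wedgeCount_factorsThroughHomology`
  (a HYPOTHESIS), applied to the shifted coordinate `TH - t` (same differential,
  `caseB_mfderiv_sub_const`; compact zero set `K_t`), gives an additive `c_t : H₂(X; ℤ) → ℤ`
  computing the count of every sphere not inside `K_t`; by homotopy invariance of singular homology
  (`singularHomology.map_eq_of_homotopic`) `F_*[ℂℙ¹] = (F₀)_*[ℂℙ¹]`, and the reference count is `1`
  (`count_ref`; `S₀` is not inside `K_t` as `u₀ 0 ∉ UH`).  So a sphere not inside `K_t` has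
  count `1` (`classCount_of_exists_notMem`).  A sphere inside `K_t` (then also `v 0 ∈ K_t`,
  `caseB_mem_of_forall_mem`) misses a second small level `K_{t'}`, `t' ≠ t`, entirely, so its count
  against `TH - t'` is `0` (empty index sets) — but it is `1` by the first case: contradiction.
* L3 `helper_leaf_meetsOnce`: L2 at `t = 0` feeds the landed `helper_countOneStructure`: a leaf
  meets `S_H` at exactly one parameter point, simply, in the affine chart XOR at `v 0`.

References: C. Wendl, *Holomorphic Curves in Low Dimensions* (2018), §2.2.2 (homological
intersection counts); A. Hatcher, *Algebraic Topology* (2002), Thm. 2.10 (homotopy invariance);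
M. Gromov, Invent. Math. 82 (1985) §2.4 and D. McDuff, J. Amer. Math. Soc. 3 (1990) (foliating by
`J`-spheres).  No new definitions, notation or instances.
-/

noncomputable section

open scoped Manifold ContDiff Topology
open Set Function Filter Literature.Topology.FourManifolds Literature.Topology.FourManifolds.ComplexProjectiveSpace
  Literature.Geometry.Kaehler Literature.Geometry.Symplectic Literature.AlgebraicTopology.SingularHomology

-- the prescribed namespace `Summit.<P>.<Sub>.…` duplicates `SmoothPoincare4` (P = Sub)
set_option linter.dupNamespace false

namespace Summit.SmoothPoincare4.SmoothPoincare4.Theorems.GromovRecognitionRelEnd.CrossCapLaurent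

/-! ### L0: holomorphic coordinates are submersions -/

/-- **A non-zero complex-linear real functional is onto `ℂ`.**  If `ℓ : V →ₗ[ℝ] ℂ` satisfies
`ℓ (J w) = i · ℓ w` for an operator `J` on `V` and `ℓ w ≠ 0` for some `w`, then `ℓ` is surjective:
`ℓ (s • w + r • J w) = (s + r i) · ℓ w` and `c = (c / ℓ w) · ℓ w`. -/
theorem surjective_of_map_J_eq_I_mul {V : Type*} [AddCommGroup V] [Module ℝ V] {ℓ : V →ₗ[ℝ] ℂ}
    {J : V → V} (hJ : ∀ w, ℓ (J w) = Complex.I * ℓ w) {w : V} (hw : ℓ w ≠ 0) :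
    Surjective ℓ := by
  intro c
  refine ⟨(c / ℓ w).re • w + (c / ℓ w).im • J w, ?_⟩
  rw [map_add, map_smul, map_smul, hJ, Complex.real_smul, Complex.real_smul]
  calc ((c / ℓ w).re : ℂ) * ℓ w + ((c / ℓ w).im : ℂ) * (Complex.I * ℓ w)
      = (((c / ℓ w).re : ℂ) + ((c / ℓ w).im : ℂ) * Complex.I) * ℓ w := by ring
    _ = c / ℓ w * ℓ w := by rw [Complex.re_add_im]
    _ = c := div_mul_cancel₀ c hw

/-- **L0 (registered helper `helper_holCoordinate_surjective`): a holomorphic coordinate is a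
submersion.**  For `T` a `JX`-holomorphic coordinate on `U` (`IsHolCoordinate`: `dT ∘ JX = i · dT`,
`dT ≠ 0` on `U`) and `y ∈ U`, the differential `dT_y : T_y X → ℂ` is onto: its range is a non-zero
real subspace of `ℂ` stable under multiplication by `i` (`surjective_of_map_J_eq_I_mul`). -/
theorem helper_holCoordinate_surjective : ∀ (X : Type) [TopologicalSpace X]
    [ChartedSpace (EuclideanSpace ℝ (Fin 4)) X] [IsManifold (𝓡 4) ∞ X]
    (JX : ∀ y : X, TangentSpace (𝓡 4) y →L[ℝ] TangentSpace (𝓡 4) y) (T : X → ℂ) (U : Set X),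
    IsHolCoordinate JX T U → ∀ y ∈ U, Surjective (mfderiv (𝓡 4) 𝓘(ℝ, ℂ) T y) := by
  intro X _ _ _ JX T U hT y hy
  -- a vector on which `dT_y` does not vanish
  obtain ⟨w, hw⟩ : ∃ w : TangentSpace (𝓡 4) y, mfderiv (𝓡 4) 𝓘(ℝ, ℂ) T y w ≠ 0 := by
    by_contra! h
    exact hT.mfderiv_ne_zero y hy (ContinuousLinearMap.ext fun x => by simpa using h x)
  exact surjective_of_map_J_eq_I_mul (V := TangentSpace (𝓡 4) y)
    (ℓ := (mfderiv (𝓡 4) 𝓘(ℝ, ℂ) T y).toLinearMap) (J := fun w => JX y w) (hT.hol y hy) hw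

/-! ### L1: the reference sphere is a leaf -/

/-- **L1 (registered helper `helper_leaf_ref`): the reference sphere is a leaf of its family.**
Given the foliation data, `S₀ = (u₀, v₀)` is a smooth embedded `JX`-two-chart sphere (fields
`ref_sphere`, `ref_embedded`), its glued map `F₀` (`ref_glued`) is homotopic to itself, and
`(UV, TV)` is a trivial-normal-bundle witness: `UV` is open, `TV` is smooth and submersive on `UV`
(`coordV` and L0) with zero set `im S₀` (`zeroSetV`), which in particular contains the image. -/
theorem helper_leaf_ref : ∀ (X : Type) [TopologicalSpace X] [T2Space X] [SecondCountableTopology X]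
    [CompactSpace X] [ConnectedSpace X] [ChartedSpace (EuclideanSpace ℝ (Fin 4)) X]
    [IsManifold (𝓡 4) ∞ X] (ωX : MForm (𝓡 4) X ℝ 2) (JX : AlmostComplexStructure (𝓡 4) ∞ X)
    (u₀ v₀ uH vH : ℂ → X) (F₀ : C(ComplexProjectiveSpace 1, X)) (TH TV : X → ℂ) (UH UV : Set X)
    (δ : ℝ), FoliationData ωX JX u₀ v₀ uH vH F₀ TH TV UH UV δ →
    IsLeafOf (fun y => JX y) F₀ u₀ v₀ := by
  intro X _ _ _ _ _ _ _ ωX JX u₀ v₀ uH vH F₀ TH TV UH UV δ D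
  -- the zero set of `TV` on `UV` is exactly the image of the reference sphere
  have hzero : {y | y ∈ UV ∧ TV y = 0} = range u₀ ∪ {v₀ 0} :=
    D.zeroSetV.trans (pairImage_eq u₀ v₀)
  have hsub : range u₀ ∪ {v₀ 0} ⊆ UV := fun y hy => by
    rw [← hzero] at hy
    exact hy.1
  have hW : IsNormalWitness UV TV u₀ v₀ :=
    { isOpen := D.coordV.isOpen
      image_subset := hsub
      smooth := D.coordV.smooth
      submersive := helper_holCoordinate_surjective X (fun y => JX y) TV UV D.coordV
      zeroSet_eq := hzero }
  exact ⟨D.ref_sphere, D.ref_embedded, ⟨UV, TV, hW⟩,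
    ⟨F₀, D.ref_glued, ContinuousMap.Homotopic.refl F₀⟩⟩

/-! ### L2: spheres in the class of the reference sphere have count one -/

/-- **Count one for spheres not inside the level.**  With the foliation data and the fact
`jSphere_wedgeCount_factorsThroughHomology` (hypothesis), for `‖t‖ < δ` every `JX`-two-chart
sphere `(u, v)` with glued map `F` homotopic to `F₀` and NOT inside `K_t = {y ∈ UH | TH y = t}`
has `wedgeCount (TH - t) UH u v = 1`: the fact applied to the shifted coordinate `TH - t` (same
differential, `caseB_mfderiv_sub_const`; compact zero set `K_t`, `levelsH`) gives an additive
`c_t` on `H₂(X; ℤ)` computing the counts of `(u, v)` and of the reference sphere (not inside `K_t`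
since `u₀ 0 ∉ UH`) from the classes `F_*[ℂℙ¹] = (F₀)_*[ℂℙ¹]`
(`singularHomology.map_eq_of_homotopic`), and the reference count is `1` (`count_ref`). -/
theorem classCount_of_exists_notMem {X : Type} [TopologicalSpace X] [T2Space X]
    [SecondCountableTopology X] [CompactSpace X] [ChartedSpace (EuclideanSpace ℝ (Fin 4)) X]
    [IsManifold (𝓡 4) ∞ X] {ωX : MForm (𝓡 4) X ℝ 2} {JX : AlmostComplexStructure (𝓡 4) ∞ X}
    {u₀ v₀ uH vH : ℂ → X} {F₀ : C(ComplexProjectiveSpace 1, X)} {TH TV : X → ℂ} {UH UV : Set X}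
    {δ : ℝ} (hfact : jSphere_wedgeCount_factorsThroughHomology)
    (D : FoliationData ωX JX u₀ v₀ uH vH F₀ TH TV UH UV δ) {u v : ℂ → X}
    {F : C(ComplexProjectiveSpace 1, X)} (huv : TwoChartSphere (fun y => JX y) u v)
    (hF : IsGlued F u v) (hhom : F.Homotopic F₀) {t : ℂ} (ht : ‖t‖ < δ)
    (hnot : ∃ z : ℂ, ¬ (u z ∈ UH ∧ TH (u z) - t = 0)) :
    wedgeCount (fun y => TH y - t) UH u v = 1 := by
  have hUH : IsOpen UH := D.coordH.isOpen
  have hTH : ContMDiffOn (𝓡 4) 𝓘(ℝ, ℂ) ∞ TH UH := D.coordH.smooth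
  -- the shifted coordinate `TH - t` satisfies the hypotheses of the fact
  have hT' : ContMDiffOn (𝓡 4) 𝓘(ℝ, ℂ) ∞ (fun y => TH y - t) UH := hTH.sub contMDiffOn_const
  have hTJ' : ∀ y ∈ UH, ∀ w : TangentSpace (𝓡 4) y,
      (show ℂ from mfderiv (𝓡 4) 𝓘(ℝ, ℂ) (fun y => TH y - t) y (JX y w)) =
        Complex.I * (show ℂ from mfderiv (𝓡 4) 𝓘(ℝ, ℂ) (fun y => TH y - t) y w) :=
    fun y hy w => by rw [caseB_mfderiv_sub_const hUH hTH t hy]; exact D.coordH.hol y hy w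
  have hdT' : ∀ y ∈ UH, mfderiv (𝓡 4) 𝓘(ℝ, ℂ) (fun y => TH y - t) y ≠ 0 :=
    fun y hy => by rw [caseB_mfderiv_sub_const hUH hTH t hy]; exact D.coordH.mfderiv_ne_zero y hy
  have hK' : IsCompact {y : X | y ∈ UH ∧ (fun y => TH y - t) y = 0} := by
    simpa only [sub_eq_zero] using D.levelsH t ht
  obtain ⟨c, hc⟩ := hfact X JX (fun y => TH y - t) UH hUH hT' hTJ' hdT' hK'
  -- the reference sphere is not inside `K_t`
  have h₀ : ∃ z : ℂ, ¬ (u₀ z ∈ UH ∧ (fun y => TH y - t) (u₀ z) = 0) :=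
    ⟨0, fun h => D.ref_off h.1⟩
  have hc₀ := hc u₀ v₀ F₀ D.ref_sphere.smooth_u D.ref_sphere.smooth_v D.ref_sphere.compat
    D.ref_sphere.hol_u D.ref_sphere.hol_v D.ref_glued.chart_zero D.ref_glued.chart_one h₀
  have hcF := hc u v F huv.smooth_u huv.smooth_v huv.compat huv.hol_u huv.hol_v hF.chart_zero
    hF.chart_one hnot
  calc wedgeCount (fun y => TH y - t) UH u v
      = c (singularHomology.map ℤ ℤ F (2 * 1)
          (ComplexProjectiveSpace.homologicalOrientationInt 1).fundamentalClass) := hcF.symm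
    _ = c (singularHomology.map ℤ ℤ F₀ (2 * 1)
          (ComplexProjectiveSpace.homologicalOrientationInt 1).fundamentalClass) := by
        rw [singularHomology.map_eq_of_homotopic ℤ ℤ hhom (2 * 1)]
    _ = wedgeCount (fun y => TH y - t) UH u₀ v₀ := hc₀
    _ = 1 := D.count_ref t ht

/-- **L2 (registered helper `helper_class_count`): every `JX`-sphere in the class of the reference
sphere meets every small `H`-level with count one, and is inside none of them.**  If `(u, v)` is
not inside `K_t` this is `classCount_of_exists_notMem`.  If it were inside `K_t` (all `u z ∈ UH`
with `TH (u z) = t`, hence also `v 0`, `caseB_mem_of_forall_mem`, `K_t` being compact hence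
closed), pick a second small level `t' ≠ t` (`t' = 0` if `t ≠ 0`, else `t' = δ / 2`): the sphere
misses `K_{t'}` entirely, so both index sets of `wedgeCount (TH - t') UH u v` are empty and the
count is `0`, while `classCount_of_exists_notMem` at `t'` gives `1` — a contradiction. -/
theorem helper_class_count : ∀ (X : Type) [TopologicalSpace X] [T2Space X] [SecondCountableTopology X]
    [CompactSpace X] [ConnectedSpace X] [ChartedSpace (EuclideanSpace ℝ (Fin 4)) X]
    [IsManifold (𝓡 4) ∞ X] (ωX : MForm (𝓡 4) X ℝ 2) (JX : AlmostComplexStructure (𝓡 4) ∞ X)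
    (u₀ v₀ uH vH : ℂ → X) (F₀ : C(ComplexProjectiveSpace 1, X)) (TH TV : X → ℂ) (UH UV : Set X)
    (δ : ℝ), jSphere_wedgeCount_factorsThroughHomology →
    FoliationData ωX JX u₀ v₀ uH vH F₀ TH TV UH UV δ →
    ∀ (u v : ℂ → X) (F : C(ComplexProjectiveSpace 1, X)),
    TwoChartSphere (fun y => JX y) u v → IsGlued F u v → F.Homotopic F₀ →
    ∀ t : ℂ, ‖t‖ < δ →
      wedgeCount (fun y => TH y - t) UH u v = 1 ∧ ∃ z : ℂ, ¬ (u z ∈ UH ∧ TH (u z) - t = 0) := by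
  intro X _ _ _ _ _ _ _ ωX JX u₀ v₀ uH vH F₀ TH TV UH UV δ hfact D u v F huv hF hhom t ht
  by_cases hall : ∀ z : ℂ, u z ∈ UH ∧ TH (u z) = t
  swap
  · -- the sphere is not inside `K_t`: count one
    have hnot : ∃ z : ℂ, ¬ (u z ∈ UH ∧ TH (u z) - t = 0) := by
      by_contra h
      exact hall fun z => by
        by_contra hz
        exact h ⟨z, fun hz' => hz ⟨hz'.1, sub_eq_zero.mp hz'.2⟩⟩
    exact ⟨classCount_of_exists_notMem hfact D huv hF hhom ht hnot, hnot⟩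
  · -- the sphere is inside `K_t`: impossible
    exfalso
    have hKc : IsClosed {y : X | y ∈ UH ∧ TH y = t} := (D.levelsH t ht).isClosed
    have hv0 : v 0 ∈ {y : X | y ∈ UH ∧ TH y = t} :=
      caseB_mem_of_forall_mem hKc huv.smooth_v.continuous huv.compat hall
    -- a second small level
    obtain ⟨t', ht', htt'⟩ : ∃ t' : ℂ, ‖t'‖ < δ ∧ t' ≠ t := by
      by_cases h0 : t = 0
      · refine ⟨((δ / 2 : ℝ) : ℂ), ?_, ?_⟩
        · rw [Complex.norm_real, Real.norm_eq_abs, abs_of_pos (half_pos D.δ_pos)]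
          exact half_lt_self D.δ_pos
        · rw [h0]
          exact Complex.ofReal_ne_zero.mpr (half_pos D.δ_pos).ne'
      · exact ⟨0, by simpa using D.δ_pos, fun h => h0 h.symm⟩
    -- the sphere misses `K_{t'}` in the affine chart, in particular it is not inside it ...
    have hmiss : ∀ z : ℂ, ¬ (u z ∈ UH ∧ TH (u z) - t' = 0) := fun z hz =>
      htt' ((sub_eq_zero.mp hz.2).symm.trans (hall z).2)
    have h1 : wedgeCount (fun y => TH y - t') UH u v = 1 :=
      classCount_of_exists_notMem hfact D huv hF hhom ht' ⟨0, hmiss 0⟩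
    -- ... and at the point at infinity, so the count vanishes
    have hS₁ : {z : ℂ | u z ∈ UH ∧ TH (u z) - t' = 0} = ∅ :=
      Set.eq_empty_of_forall_notMem fun z hz => hmiss z hz
    have hS₂ : {w : ℂ | w = 0 ∧ v w ∈ UH ∧ TH (v w) - t' = 0} = ∅ :=
      Set.eq_empty_of_forall_notMem fun w ⟨hw0, _, hw⟩ => by
        subst hw0
        exact htt' ((sub_eq_zero.mp hw).symm.trans hv0.2)
    have h0 : wedgeCount (fun y => TH y - t') UH u v = 0 := by
      show (∑ᶠ z ∈ {z : ℂ | u z ∈ UH ∧ TH (u z) - t' = 0},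
            (meromorphicOrderAt ((fun y => TH y - t') ∘ u) z).untop₀) +
          (∑ᶠ w ∈ {w : ℂ | w = 0 ∧ v w ∈ UH ∧ TH (v w) - t' = 0},
            (meromorphicOrderAt ((fun y => TH y - t') ∘ v) w).untop₀) = 0
      rw [hS₁, hS₂, finsum_mem_empty, finsum_mem_empty, add_zero]
    rw [h0] at h1
    exact zero_ne_one h1

/-! ### L3: a leaf meets the transverse wedge sphere once, simply -/

/-- **L3 (registered helper `helper_leaf_meetsOnce`): a leaf meets the transverse wedge sphere at
exactly one parameter point, simply.**  By L2 at `t = 0` a leaf `(u, v)` (its glued map is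
homotopic to `F₀`) has `wedgeCount TH UH u v = 1` and is not inside `{TH = 0} ∩ UH = im S_H`;
the landed `helper_countOneStructure` (zero set closed since the level `{TH = 0}` is compact)
turns count one into: a single simple zero of `TH ∘ u` and `v 0 ∉ S_H`, or no zero of `TH ∘ u`
and a simple zero of `TH ∘ v` at `0`. -/
theorem helper_leaf_meetsOnce : ∀ (X : Type) [TopologicalSpace X] [T2Space X]
    [SecondCountableTopology X] [CompactSpace X] [ConnectedSpace X]
    [ChartedSpace (EuclideanSpace ℝ (Fin 4)) X] [IsManifold (𝓡 4) ∞ X] (ωX : MForm (𝓡 4) X ℝ 2)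
    (JX : AlmostComplexStructure (𝓡 4) ∞ X) (u₀ v₀ uH vH : ℂ → X)
    (F₀ : C(ComplexProjectiveSpace 1, X)) (TH TV : X → ℂ) (UH UV : Set X) (δ : ℝ),
    jSphere_wedgeCount_factorsThroughHomology →
    FoliationData ωX JX u₀ v₀ uH vH F₀ TH TV UH UV δ →
    ∀ (u v : ℂ → X), IsLeafOf (fun y => JX y) F₀ u v →
    (∃ z₀ : ℂ, (u z₀ ∈ UH ∧ TH (u z₀) = 0) ∧ (∀ z : ℂ, u z ∈ UH ∧ TH (u z) = 0 → z = z₀) ∧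
        ¬ (v 0 ∈ UH ∧ TH (v 0) = 0) ∧ deriv (TH ∘ u) z₀ ≠ 0) ∨
      ((∀ z : ℂ, ¬ (u z ∈ UH ∧ TH (u z) = 0)) ∧ (v 0 ∈ UH ∧ TH (v 0) = 0) ∧
        deriv (TH ∘ v) 0 ≠ 0) := by
  intro X _ _ _ _ _ _ _ ωX JX u₀ v₀ uH vH F₀ TH TV UH UV δ hfact D u v hleaf
  obtain ⟨F, hF, hhom⟩ := hleaf.glued
  have hδ0 : ‖(0 : ℂ)‖ < δ := by simpa using D.δ_pos
  obtain ⟨hcount, hnot⟩ := helper_class_count X ωX JX u₀ v₀ uH vH F₀ TH TV UH UV δ hfact D u v F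
    hleaf.sphere hF hhom 0 hδ0
  -- read L2 at `t = 0` for the coordinate `TH` itself
  have hT0 : (fun y => TH y - 0) = TH := funext fun y => sub_zero (TH y)
  rw [hT0] at hcount
  have hex : ∃ z : ℂ, ¬ (u z ∈ UH ∧ TH (u z) = 0) := by simpa only [sub_zero] using hnot
  have hcl : IsClosed {y : X | y ∈ UH ∧ TH y = 0} := (D.levelsH 0 hδ0).isClosed
  exact helper_countOneStructure X (fun y => JX y) TH UH u v D.coordH.isOpen D.coordH.smooth
    D.coordH.hol hcl hleaf.sphere.smooth_u hleaf.sphere.smooth_v hleaf.sphere.compat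
    hleaf.sphere.hol_u hleaf.sphere.hol_v hex ((wedgeCount_eq TH UH u v).symm.trans hcount)

end Summit.SmoothPoincare4.SmoothPoincare4.Theorems.GromovRecognitionRelEnd.CrossCapLaurent

end
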